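import Summits.RiemannHypothesis.RiemannHypothesis.Theorems.WeilTwoPrimeDeflE72Def
import HarnessLib

/-!
# Deflated two-prime certificate E72: the value of `κ`, `β₂₃ ≤ κ`, `κ − β₂₃ = κ'`, and the scalar side conditions

`weilCertDeflE72.kappaQ` evaluated by the kernel, the level identities, and `checkScalars` with `κ` rewritten to its value first. Pure proof file.
-/

noncomputable section

namespace Summit.RiemannHypothesis.RiemannHypothesis.Theorems.EvenWinsBeyondArch

open Literature.NumberTheory.LFunctions

set_option maxHeartbeats 0 in
/-- **The value of `κ`** of certificate E72. [folklore] -/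
theorem kappaQ_weilCertDeflE72 : weilCertDeflE72.kappaQ = weilCertDeflE72KappaLit := by
  have h : decide (weilCertDeflE72.kappaQ = weilCertDeflE72KappaLit) = true := by decide +kernel
  exact of_decide_eq_true h

/-- `β₂₃ ≤ κ` for certificate E72. [folklore] -/
theorem beta_le_kappaQ_weilCertDeflE72 : weilCertDeflE72Beta ≤ weilCertDeflE72.kappaQ := by
  rw [kappaQ_weilCertDeflE72]; unfold weilCertDeflE72Beta weilCertDeflE72KappaLit; norm_num

/-- `κ − β₂₃ = κ'` for certificate E72. [folklore] -/
theorem kappaQ_sub_beta_weilCertDeflE72 : weilCertDeflE72.kappaQ - weilCertDeflE72Beta = weilCertDeflE72Kappa' := by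
  rw [kappaQ_weilCertDeflE72]; unfold weilCertDeflE72Beta weilCertDeflE72KappaLit weilCertDeflE72Kappa'; norm_num

set_option maxHeartbeats 0 in
/-- **Kernel check of the scalar side conditions** of certificate E72. [folklore] -/
theorem checkScalars_weilCertDeflE72 : weilCertDeflE72.checkScalars = true := by
  have h : weilCertDeflE72.checkScalars = (decide (1 ≤ weilCertDeflE72.j) && decide (0 < weilCertDeflE72.b) && decide (weilCertDeflE72.b ≤ weilCertDeflE72.base.a0) &&
      decide (weilCertDeflE72.base.a0 ≤ 1) && decide (0 < weilCertDeflE72.base.T) && decide (2 * weilCertDeflE72.base.a0 * weilCertDeflE72.base.T ≤ (weilCertDeflE72.base.N : ℚ) + 2) &&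
      decide (2 * (weilCertDeflE72.base.a0 * weilCertDeflE72.base.T) ^ (weilCertDeflE72.base.N + 1) / (weilCertDeflE72.base.N + 1).factorial ≤ 1) &&
      decide (weilCertDeflE72.base.N + 1 = 2 * weilCertDeflE72.base.nb) && decide (0 ≤ weilCertDeflE72.kappaQ)) := rfl
  rw [h, kappaQ_weilCertDeflE72]
  decide +kernel

end Summit.RiemannHypothesis.RiemannHypothesis.Theorems.EvenWinsBeyondArch
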